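import Summits.AtomisticToContinuum.FouriersLaw.Theorems.OddSectorIrreversibilityOddCorrectorDecayCurrentVarianceC
import Summits.AtomisticToContinuum.FouriersLaw.Theorems.BondHeatUncertaintyLightConeBondHeatStatics
import Literature.MathematicalPhysics.KineticTheory.ChainReflection
import HarnessLib

/-!
# `stub_fixedHorizonMatching` of line `loomis-compact-horizon-witness`, part 3: the static leaf (A₂)
(crux `EmbeddedDrudeMourre.AbelThermodynamicLimit`, item stmt-AtomisticToContinuum-12596;
`--supports` file proving the registered leaf `stub_centralBondCurrentSecondMoments`, closes nothing)

The window reduction of S4 (`…FixedHorizonMatchingWindowLeaves`) consumes three leaves; (A₂) asks for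
an `N`-uniform bound on the second moments `⟨j_k²⟩_{N,T} = ∫ j_k² dμ_{N,T}` of the bond currents of the
free-boundary Gibbs measure `μ_{N,T} = gibbsMeasure N T` on every central window. This file PROVES it,
in the stronger all-bonds form `∃ M, ∀ N k, ⟨j_k²⟩_{N,T} ≤ M` (`pinnedChain_integral_sq_bondCurrent_gibbsMeasure_le`):

* `⟨j_k²⟩ e^{-H/T}`-integral `≤ 2T ∫ r² e^{-H/T} + 2Tβ² ∫ r⁶ e^{-H/T}`, `r = q_{k+1} - q_k` (tree:
  `LightConeBondHeat.pinnedChain_integral_sq_bondCurrent_mul_gibbsDensity_le`, Gaussian momenta);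
* `r² ≤ 2(q_k² + q_{k+1}²)`, `r⁶ ≤ 32(q_k⁶ + q_{k+1}⁶)` (`ChainVariation.sub_pow_six_le`), and the `N`-UNIFORM ONE-SITE DOMINATION of the
  even position moments at EVERY site, `∫ q_k^{2j} e^{-H/T} ≤ κ_{2j} ∫ e^{-H/T}` with the one-site ratio
  `κ_{2j} = ∫ a^{2j} e^{-U(a)/T} da / ∫ e^{-U/T}` (tree: `ChainVariation.pinnedChain_integral_coord_pow_mul_gibbsDensity_le`,
  transfer recursion with radially monotone factors + Chebyshev's integral inequality);
* so `⟨j_k²⟩_{N,T} ≤ 8Tκ₂ + 128Tβ²κ₆` for every genuine bond, and `j_{N-1} ≡ 0` at the phantom last bond.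
-/

noncomputable section

open MeasureTheory ProbabilityTheory Filter Topology Set Function
open scoped NNReal ENNReal

namespace Summit.AtomisticToContinuum.FouriersLaw.Theorems.AbelThermodynamicLimit.LoomisCompactHorizonWitness

open Literature.MathematicalPhysics.KineticTheory.HeatConduction
open Literature.MathematicalPhysics.KineticTheory OscillatorChain
open Summit.AtomisticToContinuum.FouriersLaw.Theorems.SubdiffusiveBondHeat
open Summit.AtomisticToContinuum.FouriersLaw.Theorems.LightConeBondHeat
open Summit.AtomisticToContinuum.FouriersLaw.Theorems.ChainVariation

section Moments

variable {ω₂ lam β γ : ℝ} (hω : 0 < ω₂) (hl : 0 < lam) (hβ : 0 < β) {T : ℝ} (hT : 0 < T)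
include hω hl hβ hT

/-- **`N`-uniform second moments of ALL bond currents**: there is `M = M(ω₂, lam, β, T)` with
`∫ j_k² dμ_{N,T} ≤ M` for every `N` and every `k : Fin N` (`M = 8Tκ₂ + 128Tβ²κ₆` with the one-site
moment ratios `κ_{2j}`; one-site domination of `⟨q_k^{2j}⟩` at every site, Gaussian momenta).
[folklore] -/
theorem pinnedChain_integral_sq_bondCurrent_gibbsMeasure_le :
    ∃ M : ℝ, ∀ (N : ℕ) (k : Fin N),
      ∫ z, ((pinnedChain ω₂ lam β γ).bondCurrent N k z) ^ 2 ∂((pinnedChain ω₂ lam β γ).gibbsMeasure N T) ≤ M := by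
  set P := pinnedChain ω₂ lam β γ with hP
  -- the one-site moment ratios `κ₂`, `κ₆`
  set κ : ℕ → ℝ := fun j =>
    ((∫⁻ a, ENNReal.ofReal (a ^ (2 * j)) * ENNReal.ofReal (Real.exp (-P.U a / T))) /
      ∫⁻ a, ENNReal.ofReal (Real.exp (-P.U a / T))).toReal with hκ
  have hκ0 : ∀ j, 0 ≤ κ j := fun j => ENNReal.toReal_nonneg
  refine ⟨8 * T * κ 1 + 128 * T * β ^ 2 * κ 3, fun N k => ?_⟩
  have hM0 : 0 ≤ 8 * T * κ 1 + 128 * T * β ^ 2 * κ 3 := by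
    have := hκ0 1; have := hκ0 3; positivity
  set ρ := P.gibbsDensity N T with hρ
  set Z : ℝ := ∫ x, ρ x with hZ
  have hZpos : 0 < Z := integral_exp_pos (pinnedChain_integrable_gibbsDensity hω hl.le hβ.le γ N hT)
  rw [P.integral_gibbsMeasure, ← hρ, ← hZ, inv_mul_le_iff₀ hZpos]
  by_cases hk : k.val + 1 < N
  · -- a genuine bond `(k, l)`, `l = k + 1`
    set l : Fin N := ⟨k.val + 1, hk⟩ with hl'
    have hlk : l.val = k.val + 1 := rfl
    have h1 := pinnedChain_integral_sq_bondCurrent_mul_gibbsDensity_le hω hl.le hβ γ N hT hlk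
    -- position moments at the two sites, one-site dominated
    have hq2k := pinnedChain_integral_coord_pow_mul_gibbsDensity_le hω hl.le hβ.le γ hT N k 1
    have hq2l := pinnedChain_integral_coord_pow_mul_gibbsDensity_le hω hl.le hβ.le γ hT N l 1
    have hq6k := pinnedChain_integral_coord_pow_mul_gibbsDensity_le hω hl.le hβ.le γ hT N k 3
    have hq6l := pinnedChain_integral_coord_pow_mul_gibbsDensity_le hω hl.le hβ.le γ hT N l 3
    simp only [← hP, ← hρ, ← hZ] at hq2k hq2l hq6k hq6l
    change ∫ x, x.1 k ^ (2 * 1) * ρ x ≤ κ 1 * Z at hq2k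
    change ∫ x, x.1 l ^ (2 * 1) * ρ x ≤ κ 1 * Z at hq2l
    change ∫ x, x.1 k ^ (2 * 3) * ρ x ≤ κ 3 * Z at hq6k
    change ∫ x, x.1 l ^ (2 * 3) * ρ x ≤ κ 3 * Z at hq6l
    norm_num only at hq2k hq2l hq6k hq6l
    have hρ0 : ∀ x, 0 ≤ ρ x := fun x => (P.gibbsDensity_pos N T x).le
    -- `∫ r² ρ ≤ 2 ∫ q_l² ρ + 2 ∫ q_k² ρ`
    have i2k := pinnedChain_integrable_position_pow_mul_gibbsDensity hω hl hβ.le γ N hT k (m := 2) (by norm_num)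
    have i2l := pinnedChain_integrable_position_pow_mul_gibbsDensity hω hl hβ.le γ N hT l (m := 2) (by norm_num)
    have i6k := pinnedChain_integrable_position_pow_six_mul_gibbsDensity hω hl hβ.le γ N hT k
    have i6l := pinnedChain_integrable_position_pow_six_mul_gibbsDensity hω hl hβ.le γ N hT l
    have ir2 := pinnedChain_integrable_bond_sq_mul_gibbsDensity hω hl.le hβ.le γ N hT hlk
    have ir6 := pinnedChain_integrable_bond_pow_six_mul_gibbsDensity hω hl.le hβ γ N hT hlk
    have hr2 : ∫ x, (x.1 l - x.1 k) ^ 2 * ρ x ≤ 2 * ((∫ x, x.1 l ^ 2 * ρ x) + ∫ x, x.1 k ^ 2 * ρ x) := by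
      rw [← integral_add i2l i2k, ← integral_const_mul]
      refine integral_mono ir2 (((i2l.add i2k)).const_mul 2) fun x => ?_
      have : (x.1 l - x.1 k) ^ 2 ≤ 2 * (x.1 l ^ 2 + x.1 k ^ 2) := by nlinarith [sq_nonneg (x.1 l + x.1 k)]
      have := hρ0 x
      nlinarith
    have hr6 : ∫ x, (x.1 l - x.1 k) ^ 6 * ρ x ≤ 32 * ((∫ x, x.1 l ^ 6 * ρ x) + ∫ x, x.1 k ^ 6 * ρ x) := by
      rw [← integral_add i6l i6k, ← integral_const_mul]
      refine integral_mono ir6 (((i6l.add i6k)).const_mul 32) fun x => ?_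
      have := ChainVariation.sub_pow_six_le (x.1 l) (x.1 k)
      have := hρ0 x
      nlinarith
    have hT2 : 0 ≤ 2 * T := by positivity
    have hT6 : 0 ≤ 2 * T * β ^ 2 := by positivity
    calc ∫ x, P.bondCurrent N k x ^ 2 * ρ x
        ≤ 2 * T * (∫ x, (x.1 l - x.1 k) ^ 2 * ρ x) + 2 * T * β ^ 2 * ∫ x, (x.1 l - x.1 k) ^ 6 * ρ x := h1
      _ ≤ 2 * T * (2 * (κ 1 * Z + κ 1 * Z)) + 2 * T * β ^ 2 * (32 * (κ 3 * Z + κ 3 * Z)) := by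
          gcongr
          · exact hr2.trans (by linarith)
          · exact hr6.trans (by linarith)
      _ = Z * (8 * T * κ 1 + 128 * T * β ^ 2 * κ 3) := by ring
  · -- the phantom last bond: `j_{N-1} ≡ 0`
    have hlast : k.val + 1 = N := by have := k.isLt; omega
    have h0 : ∀ x, P.bondCurrent N k x = 0 := fun x => P.bondCurrent_eq_zero_of_last N k hlast x
    simp only [h0]
    norm_num
    exact mul_nonneg hZpos.le hM0

end Moments

/-- **Registered leaf `stub_centralBondCurrentSecondMoments` — (A₂) central second moments, PROVED.**
For `P = pinnedChain ω₂ lam β γ` (all `> 0`), `T > 0` and every window radius `R` there are `M`, `N₀`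
with `⟨j_k²⟩_{N,T} = ∫ j_k² dμ_{N,T} ≤ M` for all `N ≥ N₀` and all bonds `k` with `|k - c_N| ≤ R`
(in fact for all `N` and all bonds, `pinnedChain_integral_sq_bondCurrent_gibbsMeasure_le`; the
window and `γ` are not used). [folklore] -/
theorem stub_centralBondCurrentSecondMoments :
    ∀ ω₂ lam β γ : ℝ, 0 < ω₂ → 0 < lam → 0 < β → 0 < γ → ∀ T : ℝ, 0 < T →
      ∀ R : ℕ, ∃ M : ℝ, ∃ N₀ : ℕ, ∀ N : ℕ, N₀ ≤ N → ∀ k : Fin N,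
        (N - 1) / 2 ≤ k.val + R → k.val ≤ (N - 1) / 2 + R →
          ∫ z, ((Literature.MathematicalPhysics.KineticTheory.HeatConduction.pinnedChain
                  ω₂ lam β γ).bondCurrent N k z) ^ 2
            ∂((Literature.MathematicalPhysics.KineticTheory.HeatConduction.pinnedChain
                  ω₂ lam β γ).gibbsMeasure N T) ≤ M := by
  intro ω₂ lam β γ hω hl hβ _hγ T hT R
  obtain ⟨M, hM⟩ := pinnedChain_integral_sq_bondCurrent_gibbsMeasure_le (γ := γ) hω hl hβ hT
  exact ⟨M, 0, fun N _ k _ _ => hM N k⟩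

end Summit.AtomisticToContinuum.FouriersLaw.Theorems.AbelThermodynamicLimit.LoomisCompactHorizonWitness

end
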